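import Summits.CriticalPhenomena.PercolationContinuityZ3.Theorems.PercNearOneGluingNoHeavyLowerTailAvoidingWitness
import Summits.CriticalPhenomena.PercolationContinuityZ3.Theorems.PercNearOneGluingNoHeavyLowerTailAvoidingWitnessOneLayer
import HarnessLib

/-!
# `NoHeavyLowerTail` (stmt-CriticalPhenomena-4575) — Kozma–Nitzan's Conjecture 4 for ONE FAMILY OF EVENTS closes the crux

Hull-port prover #4 (prim-hp-4 gen 3).  Kozma–Nitzan (arXiv:2401.12397, Conjecture 4, p. 32) conjecture that for every monotone
cluster property `f` and every relay set `A` some `a ∈ A` has `E[f(a); o ↔ A] ≤ E[f(o); o ↔ A]`; they prove it for `|A| = 2`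
(Thm 7) and for one-layer observers (Thm 8) (tree: `KozmaNitzan2024_thm7_event`, `KozmaNitzan2024_thm8_event`).  The lead's
`Theorems.noHeavyLowerTail_of_conjecture4_geom` records that the single REAL family `F_v = −v^{|C ∩ A|}` suffices for the crux.
This file records the `{0,1}`-valued counterpart found on the LP-duality line: the single EVENT family

  `P_{a₁,j,A}(K) := (a₁ ∈ K) ∨ (j < |K ∩ A|)`      (monotone in `K`),

applied with the relay set `A ∖ {a₁}`, suffices — with constant `2`:  Conjecture 4 for `P_{a₁,j,A}` gives the avoiding-witness
bound `μ(1 ≤ N ≤ j, o ↮ a₁) ≤ μ(b ↮ a₁, M_b ≤ j)` for some `b ≠ a₁`, whence `μ(1 ≤ N ≤ j) ≤ μ(M_{a₁} ≤ j) + μ(M_b ≤ j) ≤ 2 max_a μ(M_a ≤ j)`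
(CIL with constant 2) and the crux by `Theorems.noHeavyLowerTail_of_cumulativeIsolationConst_allLevels`.  Reuses `…AvoidingWitness.lean` (the split and the
reduction to CIL(2)) and `…AvoidingWitnessOneLayer.lean` (event bookkeeping); no definitions, no sorries.
-/

noncomputable section

namespace Summit.CriticalPhenomena.PercolationContinuityZ3.Theorems

open MeasureTheory Set Literature.Probability.LatticeModels Literature.Probability.Percolation
open scoped Classical BigOperators

variable {n : ℕ}

namespace ConjectureFourEvent

/-- The avoiding-witness bound from Conjecture 4 for the event `a₁ ∈ K ∨ j < |K ∩ A|` on the relay set `A ∖ a₁`: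
`μ(1 ≤ N ≤ j, o ↮ a₁) ≤ μ(b ↮ a₁, M_b ≤ j)` for some `b ∈ A ∖ a₁`. [this file] -/
theorem avoidingMax_of_conjecture4 (w : Sym2 (Fin n) → unitInterval) (A : Finset (Fin n)) (o a₁ : Fin n) (j : ℕ)
    (ha₁ : a₁ ∈ A)
    (h4 : ∃ a ∈ A.erase a₁,
      (prodBernoulli w).real ({ω : BondConfig (Fin n) |
          a₁ ∈ openCluster ω a ∨ j < (A.filter fun z => z ∈ openCluster ω a).card} ∩ ⋃ a' ∈ A.erase a₁, openConn o a') ≤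
        (prodBernoulli w).real ({ω : BondConfig (Fin n) |
          a₁ ∈ openCluster ω o ∨ j < (A.filter fun z => z ∈ openCluster ω o).card} ∩ ⋃ a' ∈ A.erase a₁, openConn o a')) :
    ∃ b ∈ A.erase a₁,
      (prodBernoulli w).real {ω : BondConfig (Fin n) |
          1 ≤ (A.filter fun x => ω ∈ openConn o x).card ∧ (A.filter fun x => ω ∈ openConn o x).card ≤ j ∧
            ω ∉ openConn o a₁} ≤
        (prodBernoulli w).real {ω : BondConfig (Fin n) |
          ω ∉ openConn b a₁ ∧ (A.filter fun x => ω ∈ openConn b x).card ≤ j} := by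
  set μ := prodBernoulli w with hμ
  set U : Set (BondConfig (Fin n)) := ⋃ a' ∈ A.erase a₁, openConn o a' with hU
  obtain ⟨a, ha, hle⟩ := h4
  refine ⟨a, ha, ?_⟩
  have key : ∀ x : Fin n,
      μ.real ({ω : BondConfig (Fin n) |
          ω ∉ openConn x a₁ ∧ (A.filter fun z => ω ∈ openConn x z).card ≤ j} ∩ U) =
        μ.real U - μ.real ({ω : BondConfig (Fin n) |
            (a₁ ∈ openCluster ω x ∨ j < (A.filter fun z => z ∈ openCluster ω x).card)} ∩ U) := by
    intro x
    rw [← AvoidingWitnessOneLayer.real_notProp_inter_set w U A a₁ x j]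
    congr 1
    ext ω
    simp only [mem_inter_iff, mem_setOf_eq, not_or, not_lt, AvoidingWitnessOneLayer.filter_openCluster]
    exact Iff.rfl
  have hL : {ω : BondConfig (Fin n) |
        1 ≤ (A.filter fun x => ω ∈ openConn o x).card ∧ (A.filter fun x => ω ∈ openConn o x).card ≤ j ∧
          ω ∉ openConn o a₁} ⊆
      {ω : BondConfig (Fin n) | ω ∉ openConn o a₁ ∧ (A.filter fun x => ω ∈ openConn o x).card ≤ j} ∩ U := by
    intro ω hω
    simp only [mem_setOf_eq] at hω
    obtain ⟨h1, hj, hna⟩ := hω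
    refine ⟨⟨hna, hj⟩, ?_⟩
    obtain ⟨x, hx⟩ := Finset.card_pos.1 h1
    obtain ⟨hxA, hox⟩ := Finset.mem_filter.1 hx
    have hxa : x ≠ a₁ := by rintro rfl; exact hna hox
    exact mem_iUnion₂.2 ⟨x, Finset.mem_erase.2 ⟨hxa, hxA⟩, hox⟩
  calc μ.real {ω : BondConfig (Fin n) |
        1 ≤ (A.filter fun x => ω ∈ openConn o x).card ∧ (A.filter fun x => ω ∈ openConn o x).card ≤ j ∧
          ω ∉ openConn o a₁}
      ≤ μ.real ({ω : BondConfig (Fin n) | ω ∉ openConn o a₁ ∧ (A.filter fun x => ω ∈ openConn o x).card ≤ j} ∩ U) :=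
        measureReal_mono hL (measure_ne_top μ _)
    _ ≤ μ.real ({ω : BondConfig (Fin n) | ω ∉ openConn a a₁ ∧ (A.filter fun x => ω ∈ openConn a x).card ≤ j} ∩ U) := by
        rw [key o, key a]; linarith
    _ ≤ _ := measureReal_mono inter_subset_left (measure_ne_top μ _)

end ConjectureFourEvent

open ConjectureFourEvent AvoidingWitness

/-- **Kozma–Nitzan's Conjecture 4 for the event family `a₁ ∈ K ∨ j < |K ∩ A|` ⇒ CIL with constant 2 ⇒ `NoHeavyLowerTail`.**
Hypothesis: for every finite weighted graph, relay set `A` with `|A| ≥ 2`, `a₁ ∈ A`, observer `o ∉ A` and level `j`, the Conjecture-4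
inequality holds for the monotone event property `P(K) = (a₁ ∈ K) ∨ (j < |K ∩ A|)` and the relay set `A ∖ a₁`:
some `a ∈ A ∖ a₁` has `μ(P(C(a)), o ↔ A∖a₁) ≤ μ(P(C(o)), o ↔ A∖a₁)`.  By Kozma–Nitzan's Theorems 7 and 8 this holds when
`|A| = 3` and for one-layer observers (tree file `…AvoidingWitnessOneLayer.lean`); at level `j = 1` the consequence is the block
lonely relay lemma (`…AvoidingWitness.lean`). [cite: KozmaNitzan2024, Conjecture 4 (p. 32)] -/
theorem noHeavyLowerTail_of_conjecture4_event
    (h4 : ∀ (n : ℕ) (w : Sym2 (Fin n) → unitInterval) (A : Finset (Fin n)) (o a₁ : Fin n) (j : ℕ),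
      2 ≤ A.card → a₁ ∈ A → o ∉ A → ∃ a ∈ A.erase a₁,
        (prodBernoulli w).real ({ω : BondConfig (Fin n) |
            a₁ ∈ openCluster ω a ∨ j < (A.filter fun z => z ∈ openCluster ω a).card} ∩ ⋃ a' ∈ A.erase a₁, openConn o a') ≤
          (prodBernoulli w).real ({ω : BondConfig (Fin n) |
            a₁ ∈ openCluster ω o ∨ j < (A.filter fun z => z ∈ openCluster ω o).card} ∩ ⋃ a' ∈ A.erase a₁, openConn o a')) :
    Summit.CriticalPhenomena.PercolationContinuityZ3.Theses.PercNearOneGluing.NoHeavyLowerTail := by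
  refine noHeavyLowerTail_of_cumulativeIsolationConst_allLevels 2 (by norm_num) fun n w A o j hA ho => ?_
  set μ := prodBernoulli w with hμ
  obtain ⟨a₁, ha₁⟩ := hA
  by_cases h2 : 2 ≤ A.card
  · obtain ⟨b, hb, hle⟩ := avoidingMax_of_conjecture4 w A o a₁ j ha₁ (h4 n w A o a₁ j h2 ha₁ ho)
    have hbA : b ∈ A := Finset.mem_of_mem_erase hb
    set ra := μ.real {ω : BondConfig (Fin n) | (A.filter fun x => ω ∈ openConn a₁ x).card ≤ j} with hra
    set rb := μ.real {ω : BondConfig (Fin n) | (A.filter fun x => ω ∈ openConn b x).card ≤ j} with hrb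
    have hsplit := lowerTail_le_add_avoiding w A o a₁ j
    have hle' : μ.real {ω : BondConfig (Fin n) |
        1 ≤ (A.filter fun x => ω ∈ openConn o x).card ∧ (A.filter fun x => ω ∈ openConn o x).card ≤ j ∧
          ω ∉ openConn o a₁} ≤ rb :=
      le_trans hle (measureReal_mono (fun ω hω => hω.2) (measure_ne_top μ _))
    by_cases hcmp : rb ≤ ra
    · exact ⟨a₁, ha₁, by linarith⟩
    · exact ⟨b, hbA, by linarith [lt_of_not_ge hcmp]⟩
  · -- `|A| = 1`: on `{1 ≤ N}` the observer is joined to `a₁`, so `N = M_{a₁}`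
    refine ⟨a₁, ha₁, ?_⟩
    have hcard : A.card = 1 := by
      have h1 : 1 ≤ A.card := Finset.card_pos.2 ⟨a₁, ha₁⟩
      omega
    obtain ⟨a, hAeq⟩ := Finset.card_eq_one.1 hcard
    have ha₁a : a₁ = a := by rw [hAeq] at ha₁; exact Finset.mem_singleton.1 ha₁
    have hsplit := lowerTail_le_add_avoiding w A o a₁ j
    have hempty : {ω : BondConfig (Fin n) |
        1 ≤ (A.filter fun x => ω ∈ openConn o x).card ∧ (A.filter fun x => ω ∈ openConn o x).card ≤ j ∧
          ω ∉ openConn o a₁} = ∅ := by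
      ext ω
      simp only [mem_setOf_eq, mem_empty_iff_false, iff_false, not_and, not_not]
      intro h1 _
      obtain ⟨x, hx⟩ := Finset.card_pos.1 h1
      obtain ⟨hxA, hox⟩ := Finset.mem_filter.1 hx
      have hxa : x = a := by rw [hAeq] at hxA; exact Finset.mem_singleton.1 hxA
      rw [ha₁a, ← hxa]; exact hox
    rw [hempty, measureReal_empty, add_zero] at hsplit
    have hnn : 0 ≤ μ.real {ω : BondConfig (Fin n) | (A.filter fun x => ω ∈ openConn a₁ x).card ≤ j} :=
      measureReal_nonneg
    linarith

/-- Same, typed against the sibling route `PercNearOneGluingNoHeavy`. [cite: KozmaNitzan2024, Conjecture 4 (p. 32)] -/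
theorem noHeavyLowerTail_noHeavy_of_conjecture4_event
    (h4 : ∀ (n : ℕ) (w : Sym2 (Fin n) → unitInterval) (A : Finset (Fin n)) (o a₁ : Fin n) (j : ℕ),
      2 ≤ A.card → a₁ ∈ A → o ∉ A → ∃ a ∈ A.erase a₁,
        (prodBernoulli w).real ({ω : BondConfig (Fin n) |
            a₁ ∈ openCluster ω a ∨ j < (A.filter fun z => z ∈ openCluster ω a).card} ∩ ⋃ a' ∈ A.erase a₁, openConn o a') ≤
          (prodBernoulli w).real ({ω : BondConfig (Fin n) |
            a₁ ∈ openCluster ω o ∨ j < (A.filter fun z => z ∈ openCluster ω o).card} ∩ ⋃ a' ∈ A.erase a₁, openConn o a')) :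
    Summit.CriticalPhenomena.PercolationContinuityZ3.Theses.PercNearOneGluingNoHeavy.NoHeavyLowerTail :=
  noHeavyLowerTail_of_conjecture4_event h4

end Summit.CriticalPhenomena.PercolationContinuityZ3.Theorems

end
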